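import Literature.Geometry.Riemannian.BakryEmerySpectralGap
import Literature.Geometry.Riemannian.RicciFlowScalarMaximumPrinciple
import HarnessLib

/-!
# A priori properties and convergence to equilibrium of the weighted heat flow
# `∂ₜu = Δu − g⁻¹(dV, du)` on a closed manifold, and
# `carrilloNi_muEntropy_eq_log_shrinkerDensity` from the EXISTENCE of the flow alone

Companion of `BakryEmeryHeatFlow.lean` / `BakryEmerySpectralGap.lean`. The remaining input of
`carrilloNi_muEntropy_eq_log_shrinkerDensity_of_heatFlow` asked for the weighted heat flow WITH
positivity and uniform convergence to the mean; here both are DERIVED, leaving as sole input the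
existence of a smooth solution on `M × [0, ∞)`. For `g` Riemannian on a closed manifold (any model
space), `V` smooth, `dm = e^{-V} dV_g`, `L = Δ_g − g⁻¹(dV, d·)`, and `u : ℝ → M → ℝ` smooth on
`M × [0, ∞)` with `∂ₜu = Lu` there (one-sided time derivative within `[0, ∞)`), we PROVE

* `heatFlow_ge_of_ge` / `heatFlow_le_of_le` — **the weak minimum / maximum principle**:
  `a ≤ u(0, ·) ⇒ a ≤ u(t, ·)` and `u(0, ·) ≤ b ⇒ u(t, ·) ≤ b` for `t ≥ 0` (Topping 2006,
  Thm. 3.1.1 / Cor. 3.1.2: the tree's `weakMaximumPrinciple` / `weakMinimumPrinciple` with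
  `X = −♯dV`, `F = 0`); in particular positivity is preserved;
* `heatFlow_integral_eq` — **conservation of mass** `∫ u(t, ·) dm = ∫ u(0, ·) dm`;
* `derivWithin_gradSq_of_heatFlow` — `∂ₜ|∇u|² = 2 g⁻¹(du, d(Lu))` along the flow;
* `heatFlow_gradSq_le` — **the Bakry–Émery gradient bound** under `Ric + Hess V ≥ K g`:
  `|∇u(t, ·)|² ≤ e^{−2Kt} sup |∇u(0, ·)|²` (`weightedBochner_pointwise_ge` gives
  `∂ₜ|∇u|² ≤ L|∇u|² − 2K|∇u|²`; weak maximum principle with `F(r) = −2Kr`);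
* `sq_apply_le_of_posSemidef` (Cauchy–Schwarz for a positive semidefinite symmetric form) and
  `exists_nhds_abs_sub_le_sqrt` — **local oscillation estimate**: every point `x` has a
  neighbourhood `U` and a constant `C` with `|F(y) − F(x)| ≤ C √S` for `y ∈ U` and all `C¹`
  functions `F` with `|∇F|²_g ≤ S` (chart at `x`, comparison of `g` with the model norm on a
  compact ball, mean value inequality);
* `tendstoUniformly_of_gradSq_tendsto_zero` — on a compact connected manifold, `C¹` functions
  `u(t, ·)` with `sup |∇u(t,·)|²_g → 0` and constant weighted mean `m` (`∫ e^{-V} dV_g = 1`)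
  converge UNIFORMLY to `m` (clopen argument + finite subcover);
* `heatFlow_tendstoUniformly` — **convergence to equilibrium** under `Ric + Hess V ≥ K g`, `K > 0`:
  `u(t, ·) → ∫ u(0,·) dm` uniformly;
* `logSobolev_of_heatExistence` and
  **`carrilloNi_muEntropy_eq_log_shrinkerDensity_of_heatExistence`** — Carrillo–Ni's Cor. 4.1
  (closed case) from the sole hypothesis that the weighted heat equation on a closed weighted
  manifold has, for every smooth initial datum, a solution smooth on `M × [0, ∞)`.

Theorems only; no definitions, no named facts.

## References

* P. Topping, *Lectures on the Ricci flow* (2006), Thm. 3.1.1, Cor. 3.1.2. [Topping2006]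
* D. Bakry, M. Émery, *Diffusions hypercontractives*, LNM 1123 (1985). [BakryEmery1985]
* [CarrilloNi2009] J. A. Carrillo, L. Ni, Comm. Anal. Geom. 17 (2009), §3–§4, Cor. 4.1.
* A. Grigor'yan, *Heat kernel and analysis on manifolds*, AMS/IP (2009), Ch. 7 (the heat
  semigroup of a weighted manifold). [Grigoryan2009]
-/

noncomputable section

open Bundle Set Function Module Filter Manifold MeasureTheory
open scoped ContDiff Topology

namespace Literature.Geometry.Riemannian

open Lorentzian Lorentzian.PseudoRiemannianMetric

universe u

section APriori

variable {E : Type*} [NormedAddCommGroup E] [NormedSpace ℝ E] [FiniteDimensional ℝ E]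
  {H : Type*} [TopologicalSpace H] {I : ModelWithCorners ℝ E H} [I.Boundaryless]
  {M : Type*} [TopologicalSpace M] [ChartedSpace H M] [IsManifold I ∞ M]
  [CompactSpace M] [T3Space M] [MeasurableSpace M] [BorelSpace M]
  (g : PseudoRiemannianMetric I ∞ E (TangentSpace I : M → Type _)) [g.HasLeviCivita]

omit [FiniteDimensional ℝ E] [I.Boundaryless] [IsManifold I ∞ M] [CompactSpace M] [T3Space M]
  [MeasurableSpace M] [BorelSpace M] [g.HasLeviCivita] in
/-- The one-sided time derivative within `[0, T]` of a function smooth on `M × [0, ∞)` is its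
time derivative within `[0, ∞)` (`0 < T`, `t ∈ [0, T]`). [folklore] -/
theorem derivWithin_Icc_eq_derivWithin_Ici {u : ℝ → M → ℝ}
    (hu : ContMDiffOn (I.prod 𝓘(ℝ, ℝ)) 𝓘(ℝ, ℝ) ∞ (fun p : M × ℝ ↦ u p.2 p.1) (univ ×ˢ Ici 0))
    {T : ℝ} (hT : 0 < T) {t : ℝ} (ht : t ∈ Icc 0 T) (x : M) :
    derivWithin (fun s ↦ u s x) (Icc 0 T) t = derivWithin (fun s ↦ u s x) (Ici 0) t := by
  have h := hasDerivWithinAt_time_of_contMDiffOn (k := ∞) (by simp) hu x (Set.mem_Ici.2 ht.1)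
  exact (h.mono Icc_subset_Ici_self).derivWithin (uniqueDiffOn_Icc hT t ht)

omit [I.Boundaryless] [CompactSpace M] [T3Space M] [MeasurableSpace M] [BorelSpace M]
  [g.HasLeviCivita] in
/-- `du(−♯dV) = −g⁻¹(dV, du)`: the drift term of `L` as a first-order term `⟨X, ∇u⟩` with
`X = −♯dV`. [folklore] -/
theorem mvfderiv_neg_sharp_eq {V F : M → ℝ} (x : M) :
    mvfderiv I F x (-(g.sharp x (mvfderiv I V x : TangentSpace I x →ₗ[ℝ] ℝ))) =
      -g.innerDual x (mvfderiv I V x : TangentSpace I x →ₗ[ℝ] ℝ)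
        (mvfderiv I F x : TangentSpace I x →ₗ[ℝ] ℝ) := by
  rw [map_neg, g.innerDual_comm]
  rfl

omit [T3Space M] [MeasurableSpace M] [BorelSpace M] in
/-- **The weak minimum principle for the weighted heat flow** (Topping 2006, Cor. 3.1.2 with
`X = −♯dV`, `F = 0`, `φ ≡ a`): if `u` is smooth on `M × [0, ∞)`, solves `∂ₜu = Δu − g⁻¹(dV, du)`
there, and `a ≤ u(0, ·)`, then `a ≤ u(t, ·)` for all `t ≥ 0`; in particular positivity of the
initial datum is preserved. [cite: Topping2006, Cor. 3.1.2 (p. 35)] -/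
theorem heatFlow_ge_of_ge (hR : g.IsRiemannian) {V : M → ℝ} {u : ℝ → M → ℝ}
    (hu : ContMDiffOn (I.prod 𝓘(ℝ, ℝ)) 𝓘(ℝ, ℝ) ∞ (fun p : M × ℝ ↦ u p.2 p.1) (univ ×ˢ Ici 0))
    (heq : ∀ t ∈ Ici (0 : ℝ), ∀ x, derivWithin (fun s ↦ u s x) (Ici 0) t =
      g.dalembertian (u t) x - g.innerDual x (mvfderiv I V x : TangentSpace I x →ₗ[ℝ] ℝ)
        (mvfderiv I (u t) x : TangentSpace I x →ₗ[ℝ] ℝ))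
    {a : ℝ} (ha : ∀ x, a ≤ u 0 x) : ∀ t ∈ Ici (0 : ℝ), ∀ x, a ≤ u t x := by
  intro t ht x
  set T : ℝ := t + 1 with hTdef
  have hT : 0 < T := by have := Set.mem_Ici.1 ht; linarith
  have htT : t ∈ Icc 0 T := ⟨ht, by linarith⟩
  have hu' : ContMDiffOn (I.prod 𝓘(ℝ, ℝ)) 𝓘(ℝ, ℝ) ∞ (fun p : M × ℝ ↦ u p.2 p.1) (univ ×ˢ Icc 0 T) :=
    hu.mono (prod_mono le_rfl Icc_subset_Ici_self)
  have hF : ContDiffOn ℝ 1 (uncurry fun _ _ : ℝ ↦ (0 : ℝ)) (univ ×ˢ Icc 0 T) := contDiffOn_const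
  have hineq : ∀ s ∈ Icc 0 T, ∀ y : M,
      ((fun _ : ℝ ↦ g) s).laplaceBeltrami (u s) y
        + mvfderiv I (u s) y ((fun (_ : ℝ) (y : M) ↦
            -(g.sharp y (mvfderiv I V y : TangentSpace I y →ₗ[ℝ] ℝ))) s y)
        + (fun _ _ : ℝ ↦ (0 : ℝ)) (u s y) s ≤
      derivWithin (fun r ↦ u r y) (Icc 0 T) s := by
    intro s hs y
    rw [derivWithin_Icc_eq_derivWithin_Ici hu hT hs, heq s (Set.mem_Ici.2 hs.1),
      laplaceBeltrami_eq_dalembertian, mvfderiv_neg_sharp_eq, add_zero, sub_eq_add_neg]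
  have h := weakMinimumPrinciple hT (g := fun _ ↦ g) (fun _ _ ↦ hR)
    (fun (_ : ℝ) (y : M) ↦ -(g.sharp y (mvfderiv I V y : TangentSpace I y →ₗ[ℝ] ℝ))) hF hu' hineq
    (φ := fun _ ↦ a) (α := a) (fun s _ ↦ by simpa using hasDerivWithinAt_const s (Icc 0 T) a)
    rfl ha
  exact h t htT x

omit [T3Space M] [MeasurableSpace M] [BorelSpace M] in
/-- **The weak maximum principle for the weighted heat flow** (Topping 2006, Thm. 3.1.1 with
`X = −♯dV`, `F = 0`, `φ ≡ b`): `u(0, ·) ≤ b` implies `u(t, ·) ≤ b` for all `t ≥ 0`.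
[cite: Topping2006, Thm. 3.1.1 (p. 35)] -/
theorem heatFlow_le_of_le (hR : g.IsRiemannian) {V : M → ℝ} {u : ℝ → M → ℝ}
    (hu : ContMDiffOn (I.prod 𝓘(ℝ, ℝ)) 𝓘(ℝ, ℝ) ∞ (fun p : M × ℝ ↦ u p.2 p.1) (univ ×ˢ Ici 0))
    (heq : ∀ t ∈ Ici (0 : ℝ), ∀ x, derivWithin (fun s ↦ u s x) (Ici 0) t =
      g.dalembertian (u t) x - g.innerDual x (mvfderiv I V x : TangentSpace I x →ₗ[ℝ] ℝ)
        (mvfderiv I (u t) x : TangentSpace I x →ₗ[ℝ] ℝ))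
    {b : ℝ} (hb : ∀ x, u 0 x ≤ b) : ∀ t ∈ Ici (0 : ℝ), ∀ x, u t x ≤ b := by
  intro t ht x
  set T : ℝ := t + 1 with hTdef
  have hT : 0 < T := by have := Set.mem_Ici.1 ht; linarith
  have htT : t ∈ Icc 0 T := ⟨ht, by linarith⟩
  have hu' : ContMDiffOn (I.prod 𝓘(ℝ, ℝ)) 𝓘(ℝ, ℝ) ∞ (fun p : M × ℝ ↦ u p.2 p.1) (univ ×ˢ Icc 0 T) :=
    hu.mono (prod_mono le_rfl Icc_subset_Ici_self)
  have hF : ContDiffOn ℝ 1 (uncurry fun _ _ : ℝ ↦ (0 : ℝ)) (univ ×ˢ Icc 0 T) := contDiffOn_const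
  have hineq : ∀ s ∈ Icc 0 T, ∀ y : M,
      derivWithin (fun r ↦ u r y) (Icc 0 T) s ≤
      ((fun _ : ℝ ↦ g) s).laplaceBeltrami (u s) y
        + mvfderiv I (u s) y ((fun (_ : ℝ) (y : M) ↦
            -(g.sharp y (mvfderiv I V y : TangentSpace I y →ₗ[ℝ] ℝ))) s y)
        + (fun _ _ : ℝ ↦ (0 : ℝ)) (u s y) s := by
    intro s hs y
    rw [derivWithin_Icc_eq_derivWithin_Ici hu hT hs, heq s (Set.mem_Ici.2 hs.1),
      laplaceBeltrami_eq_dalembertian, mvfderiv_neg_sharp_eq, add_zero, sub_eq_add_neg]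
  have h := weakMaximumPrinciple hT (g := fun _ ↦ g) (fun _ _ ↦ hR)
    (fun (_ : ℝ) (y : M) ↦ -(g.sharp y (mvfderiv I V y : TangentSpace I y →ₗ[ℝ] ℝ))) hF hu' hineq
    (φ := fun _ ↦ b) (α := b) (fun s _ ↦ by simpa using hasDerivWithinAt_const s (Icc 0 T) b)
    rfl hb
  exact h t htT x

/-- **Conservation of mass along the weighted heat flow**: `∫ u(t, ·) e^{-V} dV_g =
∫ u(0, ·) e^{-V} dV_g` for all `t ≥ 0` (`t ↦ ∫ u(t,·) dm` is continuous on `[0, ∞)` with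
derivative `∫ ∂ₜu dm = ∫ Lu dm = 0` at positive times, by the Leibniz rule on the compact
manifold and the weighted Green identity `integral_weightedLaplacian_eq_zero`). [folklore] -/
theorem heatFlow_integral_eq (hR : g.IsRiemannian) {V : M → ℝ} (hV : ContMDiff I 𝓘(ℝ, ℝ) ∞ V)
    {u : ℝ → M → ℝ}
    (hu : ContMDiffOn (I.prod 𝓘(ℝ, ℝ)) 𝓘(ℝ, ℝ) ∞ (fun p : M × ℝ ↦ u p.2 p.1) (univ ×ˢ Ici 0))
    (heq : ∀ t ∈ Ici (0 : ℝ), ∀ x, derivWithin (fun s ↦ u s x) (Ici 0) t =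
      g.dalembertian (u t) x - g.innerDual x (mvfderiv I V x : TangentSpace I x →ₗ[ℝ] ℝ)
        (mvfderiv I (u t) x : TangentSpace I x →ₗ[ℝ] ℝ)) :
    ∀ t ∈ Ici (0 : ℝ), ∫ x, u t x * Real.exp (-V x) ∂g.riemVolume =
      ∫ x, u 0 x * Real.exp (-V x) ∂g.riemVolume := by
  haveI : IsFiniteMeasure g.riemVolume := ⟨g.riemVolume_univ_lt_top⟩
  have hS : UniqueDiffOn ℝ (Ici (0 : ℝ)) := uniqueDiffOn_Ici 0
  have hV1 : ContMDiff I 𝓘(ℝ, ℝ) 1 V := hV.of_le (by norm_num)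
  -- the integrand as a smooth family and its time derivative
  have hPfam : ContMDiffOn (I.prod 𝓘(ℝ, ℝ)) 𝓘(ℝ, ℝ) ∞
      (fun p : M × ℝ ↦ u p.2 p.1 * Real.exp (-V p.1)) (univ ×ˢ Ici 0) :=
    hu.mul ((Real.contDiff_exp.comp contDiff_neg).comp_contMDiff (hV.comp contMDiff_fst)).contMDiffOn
  have hP'fam := contMDiffOn_derivWithin_time_of_uniqueDiffOn
    (u := fun s y ↦ u s y * Real.exp (-V y)) hS hPfam
  set Φ : ℝ → ℝ := fun s ↦ ∫ y, u s y * Real.exp (-V y) ∂g.riemVolume with hΦdef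
  have hΦc : ContinuousOn Φ (Ici 0) :=
    continuousOn_integral_of_continuousOn_prod g.riemVolume isClosed_Ici hPfam.continuousOn
  -- the slices
  have hslice : ∀ s ∈ Ici (0 : ℝ), ContMDiff I 𝓘(ℝ, ℝ) ∞ (u s) := fun s hs ↦
    hu.comp_contMDiff (contMDiff_id.prodMk contMDiff_const) fun y ↦ ⟨mem_univ _, hs⟩
  -- the derivative at positive times vanishes
  have hΦd : ∀ s ∈ Ioi (0 : ℝ), HasDerivAt Φ 0 s := by
    intro s hs
    have hs0 : s ∈ Ici (0 : ℝ) := Set.mem_Ici.2 (le_of_lt hs)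
    have hs' : s ∈ interior (Ici (0 : ℝ)) := by rw [interior_Ici]; exact hs
    have h := hasDerivAt_integral_of_continuousOn_prod g.riemVolume hPfam.continuousOn
      hP'fam.continuousOn
      (fun y r hr ↦ hasDerivWithinAt_time_of_contMDiffOn (k := ∞)
        (u := fun r y ↦ u r y * Real.exp (-V y)) (by simp) hPfam y hr) hs'
    have hderiv : ∀ y, derivWithin (fun r ↦ u r y * Real.exp (-V y)) (Ici 0) s =
        (g.dalembertian (u s) y - g.innerDual y (mvfderiv I V y : TangentSpace I y →ₗ[ℝ] ℝ)
          (mvfderiv I (u s) y : TangentSpace I y →ₗ[ℝ] ℝ)) * Real.exp (-V y) := by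
      intro y
      have h1 := hasDerivWithinAt_time_of_contMDiffOn (k := ∞) (by simp) hu y hs0
      rw [(h1.mul_const (Real.exp (-V y))).derivWithin (hS s hs0), heq s hs0]
    have hzero : ∫ y, derivWithin (fun r ↦ u r y * Real.exp (-V y)) (Ici 0) s ∂g.riemVolume = 0 := by
      rw [integral_congr_ae (Eventually.of_forall hderiv)]
      exact integral_weightedLaplacian_eq_zero g hR
        ((hslice s hs0).of_le (WithTop.coe_le_coe.mpr le_top)) hV1
    rw [hzero] at h
    exact h
  -- hence `Φ` is both nonincreasing and nondecreasing on `[0, ∞)`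
  have hanti : AntitoneOn Φ (Ici 0) := by
    refine antitoneOn_of_deriv_nonpos (convex_Ici 0) hΦc ?_ ?_
    · rw [interior_Ici]; exact fun s hs ↦ (hΦd s hs).differentiableAt.differentiableWithinAt
    · rw [interior_Ici]; intro s hs; rw [(hΦd s hs).deriv]
  have hmono : MonotoneOn Φ (Ici 0) := by
    refine monotoneOn_of_deriv_nonneg (convex_Ici 0) hΦc ?_ ?_
    · rw [interior_Ici]; exact fun s hs ↦ (hΦd s hs).differentiableAt.differentiableWithinAt
    · rw [interior_Ici]; intro s hs; rw [(hΦd s hs).deriv]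
  intro t ht
  exact le_antisymm (hanti (self_mem_Ici) ht ht) (hmono (self_mem_Ici) ht ht)

omit [CompactSpace M] [T3Space M] [MeasurableSpace M] [BorelSpace M] in
/-- **`∂ₜ|∇u|² = 2 g⁻¹(du, d(Lu))` along the weighted heat flow** (at every `t ≥ 0` and every
point; the time derivative of `|∇u|²` in the chart at the point,
`MetricCoord.IsMetricOn.hasDerivWithinAt_gradSqAt_static`, with `∂ₜu = Lu` read in the chart).
[folklore] -/
theorem derivWithin_gradSq_of_heatFlow {V : M → ℝ} (hV : ContMDiff I 𝓘(ℝ, ℝ) ∞ V)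
    {u : ℝ → M → ℝ}
    (hu : ContMDiffOn (I.prod 𝓘(ℝ, ℝ)) 𝓘(ℝ, ℝ) ∞ (fun p : M × ℝ ↦ u p.2 p.1) (univ ×ˢ Ici 0))
    (heq : ∀ t ∈ Ici (0 : ℝ), ∀ x, derivWithin (fun s ↦ u s x) (Ici 0) t =
      g.dalembertian (u t) x - g.innerDual x (mvfderiv I V x : TangentSpace I x →ₗ[ℝ] ℝ)
        (mvfderiv I (u t) x : TangentSpace I x →ₗ[ℝ] ℝ))
    {t : ℝ} (ht : t ∈ Ici (0 : ℝ)) (x : M) :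
    derivWithin (fun s ↦ g.gradSq (u s) x) (Ici 0) t =
      2 * g.innerDual x (mvfderiv I (u t) x : TangentSpace I x →ₗ[ℝ] ℝ)
        (mvfderiv I (fun y ↦ g.dalembertian (u t) y
          - g.innerDual y (mvfderiv I V y : TangentSpace I y →ₗ[ℝ] ℝ)
              (mvfderiv I (u t) y : TangentSpace I y →ₗ[ℝ] ℝ)) x : TangentSpace I x →ₗ[ℝ] ℝ) := by
  have hS : UniqueDiffOn ℝ (Ici (0 : ℝ)) := uniqueDiffOn_Ici 0
  have hS' : Ici (0 : ℝ) ⊆ closure (interior (Ici (0 : ℝ))) := by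
    rw [interior_Ici, closure_Ioi]
  -- the chart at `x`
  set G := chartRep I (fun _ ↦ g) x 0 with hGdef
  have hGm : MetricCoord.IsMetricOn G (extChartAt I x).target :=
    Lorentzian.OpensChart.isMetricOn_repr (val_chartPullback_eq_chartRep (fun _ : ℝ ↦ g) x 0)
  set Fh : ℝ → E → ℝ := fun s z ↦ u s ((extChartAt I x).symm z) with hFhdef
  have hu0 : extChartAt I x x ∈ (extChartAt I x).target := mem_extChartAt_target x
  set u₀ : chartTarget I x := ⟨extChartAt I x x, hu0⟩ with hu₀def
  have hΦu₀ : chartInv I x u₀ = x := extChartAt_to_inv x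
  have hslice : ∀ s ∈ Ici (0 : ℝ), ContMDiff I 𝓘(ℝ, ℝ) ∞ (u s) := fun s hs ↦
    hu.comp_contMDiff (contMDiff_id.prodMk contMDiff_const) fun y ↦ ⟨mem_univ _, hs⟩
  have hFh : ContDiffOn ℝ ∞ (fun p : E × ℝ ↦ Fh p.2 p.1) ((extChartAt I x).target ×ˢ Ici 0) :=
    contDiffOn_family_comp_extChartAt_symm hu x
  have hut : ContMDiff I 𝓘(ℝ, ℝ) ∞ (u t) := hslice t ht
  have hud : ∀ y, MDifferentiableAt I 𝓘(ℝ, ℝ) (u t) y := fun y ↦ hut.mdifferentiableAt (by simp)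
  have hVd : ∀ y, MDifferentiableAt I 𝓘(ℝ, ℝ) V y := fun y ↦ hV.mdifferentiableAt (by simp)
  have hLs : ContMDiff I 𝓘(ℝ, ℝ) ∞ (fun y ↦ g.dalembertian (u t) y
      - g.innerDual y (mvfderiv I V y : TangentSpace I y →ₗ[ℝ] ℝ)
          (mvfderiv I (u t) y : TangentSpace I y →ₗ[ℝ] ℝ)) :=
    (contMDiff_dalembertian g hut).sub (contMDiff_innerDual g hV hut)
  have hLd : MDifferentiableAt I 𝓘(ℝ, ℝ) (fun y ↦ g.dalembertian (u t) y
      - g.innerDual y (mvfderiv I V y : TangentSpace I y →ₗ[ℝ] ℝ)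
          (mvfderiv I (u t) y : TangentSpace I y →ₗ[ℝ] ℝ)) (chartInv I x u₀) :=
    hLs.mdifferentiableAt (by simp)
  -- (a) `|∇u_s|²(x)` read in the chart, for all `s ≥ 0`
  have hgrad : ∀ s ∈ Ici (0 : ℝ), g.gradSq (u s) x = MetricCoord.gradSqAt G (Fh s) (extChartAt I x x) := by
    intro s hs
    have h := gradSq_chartInv_eq g x u₀ (F := u s) ((hslice s hs).mdifferentiableAt (by simp))
    rw [hΦu₀] at h
    exact h
  have hderiv : derivWithin (fun s ↦ g.gradSq (u s) x) (Ici 0) t =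
      derivWithin (fun s ↦ MetricCoord.gradSqAt G (Fh s) (extChartAt I x x)) (Ici 0) t :=
    derivWithin_congr (fun s hs ↦ hgrad s hs) (hgrad t ht)
  -- (b) the coordinate time derivative
  have hcoord := (hGm.hasDerivWithinAt_gradSqAt_static hS hS' hFh hu0 ht).derivWithin (hS t ht)
  -- (c) `∂ₜû = (Lu) ∘ φ⁻¹` near `φ x`
  have hrep : MetricCoord.tDerivFun Fh (Ici 0) t =ᶠ[𝓝 (extChartAt I x x)]
      ((fun y ↦ g.dalembertian (u t) y
        - g.innerDual y (mvfderiv I V y : TangentSpace I y →ₗ[ℝ] ℝ)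
            (mvfderiv I (u t) y : TangentSpace I y →ₗ[ℝ] ℝ)) ∘ (extChartAt I x).symm) := by
    filter_upwards [(isOpen_extChartAt_target x).mem_nhds hu0] with z hz
    simp only [MetricCoord.tDerivFun, Function.comp_apply]
    exact heq t ht _
  -- (d) the bridge for `g⁻¹(du, d(Lu))`
  have hI : g.innerDual x (mvfderiv I (u t) x : TangentSpace I x →ₗ[ℝ] ℝ)
      (mvfderiv I (fun y ↦ g.dalembertian (u t) y
        - g.innerDual y (mvfderiv I V y : TangentSpace I y →ₗ[ℝ] ℝ)
            (mvfderiv I (u t) y : TangentSpace I y →ₗ[ℝ] ℝ)) x : TangentSpace I x →ₗ[ℝ] ℝ) =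
      fderiv ℝ (MetricCoord.tDerivFun Fh (Ici 0) t) (extChartAt I x x)
        (MetricCoord.sharpAt G (extChartAt I x x) (fderiv ℝ (Fh t) (extChartAt I x x))) := by
    have h := innerDual_chartInv_eq g x u₀ (hud _) hLd
    rw [hΦu₀] at h
    rw [h, MetricCoord.apply_sharpAt_comm (hGm.isInvertible _ hu0) (hGm.symm _ hu0),
      hrep.fderiv_eq]
    rfl
  rw [hderiv, hcoord, hI]

omit [T3Space M] [MeasurableSpace M] [BorelSpace M] in
/-- **The Bakry–Émery gradient bound along the weighted heat flow** (Bakry–Émery 1985; the local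
form of the `C(K, ∞)` condition): on a closed Riemannian manifold (any model space) with
`Ric + Hess V ≥ K g`, a solution `u` smooth on `M × [0, ∞)` of `∂ₜu = Δu − g⁻¹(dV, du)` with
`|∇u(0, ·)|² ≤ C` satisfies `|∇u(t, ·)|² ≤ e^{−2Kt} C` for all `t ≥ 0`. Proof:
`∂ₜ|∇u|² = 2g⁻¹(du, d(Lu)) ≤ L|∇u|² − 2K|∇u|²` (`derivWithin_gradSq_of_heatFlow`,
`weightedBochner_pointwise_ge`), and the weak maximum principle (Topping 2006, Thm. 3.1.1) with
`X = −♯dV`, `F(r) = −2Kr`, `φ(t) = e^{−2Kt} C`. [cite: CarrilloNi2009, §3 (C(K,∞), p. 8)] -/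
theorem heatFlow_gradSq_le (hR : g.IsRiemannian) {V : M → ℝ} {K : ℝ}
    (hV : ContMDiff I 𝓘(ℝ, ℝ) ∞ V)
    (hRic : ∀ (y : M) (X : TangentSpace I y), K * g.val y X X ≤ g.ricci y X X + g.hessian V y X X)
    {u : ℝ → M → ℝ}
    (hu : ContMDiffOn (I.prod 𝓘(ℝ, ℝ)) 𝓘(ℝ, ℝ) ∞ (fun p : M × ℝ ↦ u p.2 p.1) (univ ×ˢ Ici 0))
    (heq : ∀ t ∈ Ici (0 : ℝ), ∀ x, derivWithin (fun s ↦ u s x) (Ici 0) t =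
      g.dalembertian (u t) x - g.innerDual x (mvfderiv I V x : TangentSpace I x →ₗ[ℝ] ℝ)
        (mvfderiv I (u t) x : TangentSpace I x →ₗ[ℝ] ℝ))
    {C : ℝ} (hC : ∀ x, g.gradSq (u 0) x ≤ C) :
    ∀ t ∈ Ici (0 : ℝ), ∀ x, g.gradSq (u t) x ≤ Real.exp (-2 * K * t) * C := by
  intro t ht x
  set T : ℝ := t + 1 with hTdef
  have hT : 0 < T := by have := Set.mem_Ici.1 ht; linarith
  have htT : t ∈ Icc 0 T := ⟨ht, by linarith⟩
  have hS : UniqueDiffOn ℝ (Ici (0 : ℝ)) := uniqueDiffOn_Ici 0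
  have hslice : ∀ s ∈ Ici (0 : ℝ), ContMDiff I 𝓘(ℝ, ℝ) ∞ (u s) := fun s hs ↦
    hu.comp_contMDiff (contMDiff_id.prodMk contMDiff_const) fun y ↦ ⟨mem_univ _, hs⟩
  -- the family `w = |∇u|²`, smooth on `M × [0, ∞)`
  have hw : ContMDiffOn (I.prod 𝓘(ℝ, ℝ)) 𝓘(ℝ, ℝ) ∞
      (fun p : M × ℝ ↦ (fun s y ↦ g.gradSq (u s) y) p.2 p.1) (univ ×ˢ Ici 0) :=
    contMDiffOn_gradSq_family g hS hu
  have hw' : ContMDiffOn (I.prod 𝓘(ℝ, ℝ)) 𝓘(ℝ, ℝ) ∞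
      (fun p : M × ℝ ↦ (fun s y ↦ g.gradSq (u s) y) p.2 p.1) (univ ×ˢ Icc 0 T) :=
    hw.mono (prod_mono le_rfl Icc_subset_Ici_self)
  have hF : ContDiffOn ℝ 1 (uncurry fun r _ : ℝ ↦ -2 * K * r) (univ ×ˢ Icc 0 T) := by
    have h : ContDiff ℝ 1 fun p : ℝ × ℝ ↦ -2 * K * p.1 := contDiff_const.mul contDiff_fst
    exact h.contDiffOn
  -- the differential inequality `∂ₜw ≤ Δw + dw(X) − 2Kw`
  have hineq : ∀ s ∈ Icc 0 T, ∀ y : M,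
      derivWithin (fun r ↦ (fun s y ↦ g.gradSq (u s) y) r y) (Icc 0 T) s ≤
      ((fun _ : ℝ ↦ g) s).laplaceBeltrami ((fun s y ↦ g.gradSq (u s) y) s) y
        + mvfderiv I ((fun s y ↦ g.gradSq (u s) y) s) y ((fun (_ : ℝ) (y : M) ↦
            -(g.sharp y (mvfderiv I V y : TangentSpace I y →ₗ[ℝ] ℝ))) s y)
        + (fun r _ : ℝ ↦ -2 * K * r) ((fun s y ↦ g.gradSq (u s) y) s y) s := by
    intro s hs y
    have hs0 : s ∈ Ici (0 : ℝ) := hs.1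
    have h1 : derivWithin (fun r ↦ g.gradSq (u r) y) (Icc 0 T) s =
        derivWithin (fun r ↦ g.gradSq (u r) y) (Ici 0) s :=
      derivWithin_Icc_eq_derivWithin_Ici (u := fun s y ↦ g.gradSq (u s) y) hw hT hs y
    have h2 := derivWithin_gradSq_of_heatFlow g hV hu heq hs0 y
    have h3 := weightedBochner_pointwise_ge g hR hV hRic (hslice s hs0) y
    simp only
    rw [h1, h2, laplaceBeltrami_eq_dalembertian, mvfderiv_neg_sharp_eq]
    linarith
  -- the comparison function `φ(s) = e^{−2Ks} C`
  have hφ : ∀ s ∈ Icc 0 T, HasDerivWithinAt (fun r ↦ Real.exp (-2 * K * r) * C)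
      ((fun r _ : ℝ ↦ -2 * K * r) ((fun r ↦ Real.exp (-2 * K * r) * C) s) s) (Icc 0 T) s := by
    intro s _
    have h1 : HasDerivAt (fun r : ℝ ↦ -2 * K * r) (-2 * K) s := by
      simpa using (hasDerivAt_id s).const_mul (-2 * K)
    have h2 := (h1.exp.mul_const C).hasDerivWithinAt (s := Icc 0 T)
    have h3 : (fun r _ : ℝ ↦ -2 * K * r) ((fun r ↦ Real.exp (-2 * K * r) * C) s) s =
        Real.exp (-2 * K * s) * (-2 * K) * C := by ring
    rw [h3]
    exact h2
  have h := weakMaximumPrinciple hT (g := fun _ ↦ g) (fun _ _ ↦ hR)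
    (fun (_ : ℝ) (y : M) ↦ -(g.sharp y (mvfderiv I V y : TangentSpace I y →ₗ[ℝ] ℝ))) hF hw' hineq
    (φ := fun r ↦ Real.exp (-2 * K * r) * C) (α := C) hφ (by simp) hC
  exact h t htT x

end APriori

section LocalEstimate

variable {E : Type*} [NormedAddCommGroup E] [NormedSpace ℝ E] [FiniteDimensional ℝ E]
  {H : Type*} [TopologicalSpace H] {I : ModelWithCorners ℝ E H} [I.Boundaryless]
  {M : Type*} [TopologicalSpace M] [ChartedSpace H M] [IsManifold I ∞ M]
  (g : PseudoRiemannianMetric I ∞ E (TangentSpace I : M → Type _))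

omit [FiniteDimensional ℝ E] in
/-- **Cauchy–Schwarz for a positive semidefinite symmetric bilinear form**:
`B(a, v)² ≤ B(a, a) B(v, v)` (discriminant of `s ↦ B(a + sv, a + sv) ≥ 0`). [folklore] -/
theorem sq_apply_le_of_posSemidef (B : E →L[ℝ] E →L[ℝ] ℝ) (hs : ∀ v w, B v w = B w v)
    (hp : ∀ w, 0 ≤ B w w) (a v : E) : (B a v) ^ 2 ≤ B a a * B v v := by
  have hq : ∀ s : ℝ, 0 ≤ B v v * (s * s) + 2 * B a v * s + B a a := by
    intro s
    have h := hp (a + s • v)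
    have hexp : B (a + s • v) (a + s • v) =
        B a a + s * B a v + s * B v a + s * s * B v v := by
      simp only [map_add, map_smul, add_apply, smul_apply, smul_eq_mul]
      ring
    rw [hexp, hs v a] at h
    nlinarith [h]
  have hd := discrim_le_zero hq
  rw [discrim] at hd
  nlinarith [hd]

/-- **Local oscillation estimate on a Riemannian manifold**: every point `x` has a neighbourhood
`U` and a constant `C ≥ 0` such that `|F(y) − F(x)| ≤ C √S` for every `y ∈ U` and every `C¹`
function `F` with `|∇F|²_g ≤ S` everywhere. Proof: in the chart at `x`, on a compact ball `K` in
the target the components `G` satisfy `G_z(v, v) ≤ Λ‖v‖²`; with `α = DF̂(z)`,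
`α(v) = G_z(♯α, v) ≤ (G_z(♯α,♯α) G_z(v,v))^{1/2} = (|∇F|²_g Λ)^{1/2}‖v‖` (Cauchy–Schwarz), so
`‖DF̂‖ ≤ (ΛS)^{1/2}` on the ball and the mean value inequality bounds `|F̂(φy) − F̂(φx)|` by
`(ΛS)^{1/2} r`. [folklore] -/
theorem exists_nhds_abs_sub_le_sqrt (hR : g.IsRiemannian) (x : M) :
    ∃ U ∈ 𝓝 x, ∃ C : ℝ, 0 ≤ C ∧ ∀ (F : M → ℝ) (S : ℝ), ContMDiff I 𝓘(ℝ, ℝ) 1 F → 0 ≤ S →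
      (∀ y, g.gradSq F y ≤ S) → ∀ y ∈ U, |F y - F x| ≤ C * Real.sqrt S := by
  set G := chartRep I (fun _ ↦ g) x 0 with hGdef
  have hGm : MetricCoord.IsMetricOn G (extChartAt I x).target :=
    Lorentzian.OpensChart.isMetricOn_repr (val_chartPullback_eq_chartRep (fun _ : ℝ ↦ g) x 0)
  have hu0 : extChartAt I x x ∈ (extChartAt I x).target := mem_extChartAt_target x
  obtain ⟨r', hr', hball'⟩ := Metric.isOpen_iff.1 (isOpen_extChartAt_target x) _ hu0
  set r : ℝ := r' / 2 with hrdef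
  have hr : 0 < r := by positivity
  have hKsub : Metric.closedBall (extChartAt I x x) r ⊆ (extChartAt I x).target :=
    (Metric.closedBall_subset_ball (by rw [hrdef]; linarith : r < r')).trans hball'
  have hBsub : Metric.ball (extChartAt I x x) r ⊆ (extChartAt I x).target :=
    Metric.ball_subset_closedBall.trans hKsub
  have hKc : IsCompact (Metric.closedBall (extChartAt I x x) r) := isCompact_closedBall _ _
  letI : NormedAddCommGroup (E →L[ℝ] E →L[ℝ] ℝ) := ContinuousLinearMap.toNormedAddCommGroup
  have hGc : ContinuousOn (fun z ↦ (G z : E →L[ℝ] E →L[ℝ] ℝ)) (Metric.closedBall (extChartAt I x x) r) :=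
    hGm.contDiffOn.continuousOn.mono hKsub
  obtain ⟨Λ, hΛ⟩ := hKc.exists_bound_of_continuousOn hGc
  set Λ' : ℝ := max Λ 1 with hΛ'def
  have hΛ'pos : 0 < Λ' := lt_of_lt_of_le one_pos (le_max_right _ _)
  refine ⟨(extChartAt I x).source ∩ extChartAt I x ⁻¹' Metric.ball (extChartAt I x x) r, ?_,
    Real.sqrt Λ' * r, by positivity, ?_⟩
  · exact inter_mem (extChartAt_source_mem_nhds x)
      ((continuousAt_extChartAt x).preimage_mem_nhds (Metric.ball_mem_nhds _ hr))
  intro F S hF hS hgradF y hy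
  set Fh : E → ℝ := F ∘ (extChartAt I x).symm with hFhdef
  have hFd : ∀ y, MDifferentiableAt I 𝓘(ℝ, ℝ) F y := fun y ↦ hF.mdifferentiableAt one_ne_zero
  have hdiff : ∀ z ∈ Metric.ball (extChartAt I x x) r, DifferentiableAt ℝ Fh z := fun z hz ↦
    differentiableAt_comp_extChartAt_symm x ⟨z, hBsub hz⟩ (hFd _)
  have hbound : ∀ z ∈ Metric.ball (extChartAt I x x) r, ‖fderiv ℝ Fh z‖ ≤ Real.sqrt (Λ' * S) := by
    intro z hz
    have hzT : z ∈ (extChartAt I x).target := hBsub hz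
    have hzK : z ∈ Metric.closedBall (extChartAt I x x) r := Metric.ball_subset_closedBall hz
    have hinv := hGm.isInvertible z hzT
    have hpsd : ∀ w, 0 ≤ G z w w := by
      intro w
      by_cases hw : w = 0
      · simp [hw]
      · have h := chartPullback_pos g x ⟨z, hzT⟩ (fun w' hw' ↦ hR _ w' hw') w hw
        rw [val_chartPullback_eq_chartRep (fun _ : ℝ ↦ g) x 0 ⟨z, hzT⟩] at h
        exact h.le
    refine ContinuousLinearMap.opNorm_le_bound _ (Real.sqrt_nonneg _) fun v ↦ ?_
    set α : E →L[ℝ] ℝ := fderiv ℝ Fh z with hαdef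
    have hαv : α v = G z (MetricCoord.sharpAt G z α) v :=
      (MetricCoord.apply_sharpAt_apply hinv α v).symm
    have hcs := sq_apply_le_of_posSemidef (G z) (hGm.symm z hzT) hpsd (MetricCoord.sharpAt G z α) v
    have hgrad : G z (MetricCoord.sharpAt G z α) (MetricCoord.sharpAt G z α) =
        g.gradSq F ((extChartAt I x).symm z) := by
      rw [MetricCoord.apply_sharpAt_sharpAt hinv]
      exact (gradSq_chartInv_eq g x ⟨z, hzT⟩ (hFd _)).symm
    have hGvv : G z v v ≤ Λ' * ‖v‖ ^ 2 :=
      calc G z v v ≤ ‖G z v v‖ := Real.le_norm_self _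
        _ ≤ ‖G z‖ * ‖v‖ * ‖v‖ := (G z).le_opNorm₂ v v
        _ ≤ Λ' * ‖v‖ * ‖v‖ := by
            gcongr
            exact (hΛ z hzK).trans (le_max_left _ _)
        _ = Λ' * ‖v‖ ^ 2 := by ring
    have hsq : (α v) ^ 2 ≤ Λ' * S * ‖v‖ ^ 2 := by
      rw [hαv]
      calc (G z (MetricCoord.sharpAt G z α) v) ^ 2
          ≤ G z (MetricCoord.sharpAt G z α) (MetricCoord.sharpAt G z α) * G z v v := hcs
        _ ≤ S * (Λ' * ‖v‖ ^ 2) :=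
            mul_le_mul (by rw [hgrad]; exact hgradF _) hGvv (hpsd v) hS
        _ = Λ' * S * ‖v‖ ^ 2 := by ring
    calc ‖α v‖ = |α v| := Real.norm_eq_abs _
      _ ≤ Real.sqrt (Λ' * S * ‖v‖ ^ 2) := Real.abs_le_sqrt hsq
      _ = Real.sqrt (Λ' * S) * ‖v‖ := by
          rw [Real.sqrt_mul (by positivity), Real.sqrt_sq (norm_nonneg _)]
  have hmv := (convex_ball (extChartAt I x x) r).norm_image_sub_le_of_norm_fderiv_le hdiff hbound
    (Metric.mem_ball_self hr) hy.2
  have hy1 : Fh (extChartAt I x y) = F y := by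
    simp only [hFhdef, Function.comp_apply, (extChartAt I x).left_inv hy.1]
  have hx1 : Fh (extChartAt I x x) = F x := by
    simp only [hFhdef, Function.comp_apply, extChartAt_to_inv (I := I) x]
  have hdist : ‖extChartAt I x y - extChartAt I x x‖ ≤ r := by
    have h := hy.2
    rw [Set.mem_preimage, Metric.mem_ball, dist_eq_norm] at h
    exact h.le
  rw [hy1, hx1, Real.norm_eq_abs] at hmv
  calc |F y - F x| ≤ Real.sqrt (Λ' * S) * ‖extChartAt I x y - extChartAt I x x‖ := hmv
    _ ≤ Real.sqrt (Λ' * S) * r := mul_le_mul_of_nonneg_left hdist (Real.sqrt_nonneg _)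
    _ = Real.sqrt Λ' * r * Real.sqrt S := by rw [Real.sqrt_mul hΛ'pos.le]; ring

end LocalEstimate

section Convergence

variable {E : Type*} [NormedAddCommGroup E] [NormedSpace ℝ E] [FiniteDimensional ℝ E]
  {H : Type*} [TopologicalSpace H] {I : ModelWithCorners ℝ E H} [I.Boundaryless]
  {M : Type*} [TopologicalSpace M] [ChartedSpace H M] [IsManifold I ∞ M]
  [CompactSpace M] [T3Space M] [MeasurableSpace M] [BorelSpace M]
  (g : PseudoRiemannianMetric I ∞ E (TangentSpace I : M → Type _))

/-- **Uniform convergence to the mean from uniform decay of the gradient** on a compact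
connected Riemannian manifold: if the `C¹` functions `u(t, ·)` have `sup_M |∇u(t,·)|²_g → 0` as
`t → ∞` and constant weighted mean `∫ u(t,·) e^{-V} dV_g = m` with `∫ e^{-V} dV_g = 1`, then
`u(t, ·) → m` uniformly. Proof: by `exists_nhds_abs_sub_le_sqrt`, `u(t,y) − u(t,x) → 0` uniformly
for `y` near `x`; the set of `y` with `u(t,y) − u(t,x₀) → 0` is clopen and nonempty, hence all of
`M`; a finite subcover makes the convergence uniform, and the mean identifies the limit of
`u(t, x₀)` as `m`. [folklore] -/
theorem tendstoUniformly_of_gradSq_tendsto_zero [ConnectedSpace M] (hR : g.IsRiemannian)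
    {V : M → ℝ} (hV : ContMDiff I 𝓘(ℝ, ℝ) ∞ V) (hmass1 : ∫ x, Real.exp (-V x) ∂g.riemVolume = 1)
    {u : ℝ → M → ℝ} (hu1 : ∀ᶠ t in atTop, ContMDiff I 𝓘(ℝ, ℝ) 1 (u t))
    (hgrad : ∀ ε > 0, ∀ᶠ t in atTop, ∀ y, g.gradSq (u t) y ≤ ε) {m : ℝ}
    (hmean : ∀ᶠ t in atTop, ∫ y, u t y * Real.exp (-V y) ∂g.riemVolume = m) :
    TendstoUniformly (fun t ↦ u t) (fun _ ↦ m) atTop := by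
  haveI : Nonempty M := ConnectedSpace.toNonempty
  set x₀ : M := Classical.arbitrary M with hx₀def
  -- the local estimate at every point
  choose U hU C hC hest using fun x ↦ exists_nhds_abs_sub_le_sqrt g hR x
  -- `u(t, y) − u(t, x) → 0` uniformly for `y ∈ U x`
  have hlocal : ∀ x, ∀ ε > 0, ∀ᶠ t in atTop, ∀ y ∈ U x, |u t y - u t x| ≤ ε := by
    intro x ε hε
    set S : ℝ := (ε / (C x + 1)) ^ 2 with hSdef
    have hCpos : 0 < C x + 1 := by linarith [hC x]
    have hSpos : 0 < S := by positivity
    filter_upwards [hu1, hgrad S hSpos] with t ht hgt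
    intro y hy
    have h := hest x (u t) S ht hSpos.le hgt y hy
    have hsqrt : Real.sqrt S = ε / (C x + 1) := by
      rw [hSdef, Real.sqrt_sq (by positivity)]
    rw [hsqrt] at h
    have hle : C x * (ε / (C x + 1)) ≤ ε := by
      rw [mul_div_assoc']
      rw [div_le_iff₀ hCpos]
      nlinarith [hC x]
    exact h.trans hle
  have hpt : ∀ x, ∀ y ∈ U x, Tendsto (fun t ↦ u t y - u t x) atTop (𝓝 0) := by
    intro x y hy
    rw [Metric.tendsto_nhds]
    intro ε hε
    filter_upwards [hlocal x (ε / 2) (by positivity)] with t ht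
    rw [Real.dist_eq, sub_zero]
    exact lt_of_le_of_lt (ht y hy) (by linarith)
  -- the clopen set of points following `x₀`
  set Sx : Set M := {y | Tendsto (fun t ↦ u t y - u t x₀) atTop (𝓝 0)} with hSxdef
  have hx₀S : x₀ ∈ Sx := by
    simp only [hSxdef, Set.mem_setOf_eq, sub_self]
    exact tendsto_const_nhds
  have hopen : IsOpen Sx := by
    rw [isOpen_iff_mem_nhds]
    intro y hy
    refine mem_of_superset (hU y) fun y' hy' ↦ ?_
    have h := (hpt y y' hy').add hy
    simp only [sub_add_sub_cancel, add_zero] at h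
    exact h
  have hclosed : IsClosed Sx := by
    rw [← closure_subset_iff_isClosed]
    intro y hy
    obtain ⟨y', hy'U, hy'S⟩ := mem_closure_iff_nhds.1 hy (U y) (hU y)
    have h := (show Tendsto (fun t ↦ u t y' - u t x₀) atTop (𝓝 0) from hy'S).sub (hpt y y' hy'U)
    simp only [sub_sub_sub_cancel_left, sub_zero] at h
    exact h
  have hSuniv : Sx = univ := IsClopen.eq_univ ⟨hclosed, hopen⟩ ⟨x₀, hx₀S⟩
  have hall : ∀ y, Tendsto (fun t ↦ u t y - u t x₀) atTop (𝓝 0) := fun y ↦ by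
    have : y ∈ Sx := by rw [hSuniv]; exact mem_univ _
    exact this
  -- uniformity by compactness
  obtain ⟨T, hT⟩ := CompactSpace.elim_nhds_subcover U hU
  have hunif : ∀ ε > 0, ∀ᶠ t in atTop, ∀ y, |u t y - u t x₀| ≤ ε := by
    intro ε hε
    have hev : ∀ x ∈ T, ∀ᶠ t in atTop,
        (∀ y ∈ U x, |u t y - u t x| ≤ ε / 2) ∧ |u t x - u t x₀| ≤ ε / 2 := by
      intro x _
      refine (hlocal x (ε / 2) (by positivity)).and ?_
      have h := hall x
      rw [Metric.tendsto_nhds] at h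
      filter_upwards [h (ε / 2) (by positivity)] with t ht
      rw [Real.dist_eq, sub_zero] at ht
      exact ht.le
    filter_upwards [(T.eventually_all).2 hev] with t ht
    intro y
    have hyT : y ∈ ⋃ x ∈ T, U x := by rw [hT]; exact mem_univ _
    obtain ⟨x, hxT, hyx⟩ := Set.mem_iUnion₂.1 hyT
    obtain ⟨h1, h2⟩ := ht x hxT
    calc |u t y - u t x₀| = |(u t y - u t x) + (u t x - u t x₀)| := by ring_nf
      _ ≤ |u t y - u t x| + |u t x - u t x₀| := abs_add_le _ _
      _ ≤ ε / 2 + ε / 2 := add_le_add (h1 y hyx) h2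
      _ = ε := by ring
  -- the limit of `u(t, x₀)` is `m`
  have hWc : Continuous fun y ↦ Real.exp (-V y) := Real.continuous_exp.comp hV.continuous.neg
  have hc : ∀ ε > 0, ∀ᶠ t in atTop, |u t x₀ - m| ≤ ε := by
    intro ε hε
    filter_upwards [hunif ε hε, hmean, hu1] with t ht htm ht1
    have hint : Integrable (fun y ↦ u t y * Real.exp (-V y)) g.riemVolume :=
      g.integrable_of_continuous (ht1.continuous.mul hWc)
    have hint0 : Integrable (fun y ↦ u t x₀ * Real.exp (-V y)) g.riemVolume :=
      g.integrable_of_continuous (continuous_const.mul hWc)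
    have hrepr : u t x₀ - m = ∫ y, (u t x₀ - u t y) * Real.exp (-V y) ∂g.riemVolume := by
      have h1 : ∫ y, (u t x₀ - u t y) * Real.exp (-V y) ∂g.riemVolume =
          ∫ y, (u t x₀ * Real.exp (-V y) - u t y * Real.exp (-V y)) ∂g.riemVolume :=
        integral_congr_ae (Eventually.of_forall fun y ↦ by ring)
      rw [h1, integral_sub hint0 hint, integral_const_mul, hmass1, htm, mul_one]
    rw [hrepr]
    calc |∫ y, (u t x₀ - u t y) * Real.exp (-V y) ∂g.riemVolume|
        ≤ ∫ y, |(u t x₀ - u t y) * Real.exp (-V y)| ∂g.riemVolume := by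
          rw [← Real.norm_eq_abs]
          exact (norm_integral_le_integral_norm _).trans (le_of_eq rfl)
      _ ≤ ∫ y, ε * Real.exp (-V y) ∂g.riemVolume := by
          refine integral_mono (hint0.sub hint |>.congr (Eventually.of_forall fun y ↦ by
            simp only [Pi.sub_apply]; ring)).abs
            (g.integrable_of_continuous (continuous_const.mul hWc)) fun y ↦ ?_
          rw [abs_mul, abs_of_pos (Real.exp_pos _)]
          refine mul_le_mul_of_nonneg_right ?_ (Real.exp_pos _).le
          rw [abs_sub_comm]
          exact ht y
      _ = ε := by rw [integral_const_mul, hmass1, mul_one]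
  -- conclusion
  rw [Metric.tendstoUniformly_iff]
  intro ε hε
  filter_upwards [hunif (ε / 3) (by positivity), hc (ε / 3) (by positivity)] with t ht htc
  intro y
  rw [Real.dist_eq]
  calc |m - u t y| = |(m - u t x₀) + (u t x₀ - u t y)| := by ring_nf
    _ ≤ |m - u t x₀| + |u t x₀ - u t y| := abs_add_le _ _
    _ ≤ ε / 3 + ε / 3 := by
        refine add_le_add ?_ ?_
        · rw [abs_sub_comm]; exact htc
        · rw [abs_sub_comm]; exact ht y
    _ < ε := by linarith

variable [g.HasLeviCivita]

/-- **Convergence to equilibrium of the weighted heat flow under `Ric + Hess V ≥ K g`, `K > 0`**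
(Bakry–Émery): on a closed connected Riemannian manifold (any model space) with
`∫ e^{-V} dV_g = 1`, a solution `u` smooth on `M × [0, ∞)` of `∂ₜu = Δu − g⁻¹(dV, du)` converges
uniformly to `∫ u(0, ·) e^{-V} dV_g` as `t → ∞`: the gradient bound
`|∇u(t)|² ≤ e^{−2Kt} max |∇u(0)|²` (`heatFlow_gradSq_le`), conservation of mass
(`heatFlow_integral_eq`) and `tendstoUniformly_of_gradSq_tendsto_zero`.
[cite: CarrilloNi2009, §3 (C(K,∞), p. 8)] -/
theorem heatFlow_tendstoUniformly [ConnectedSpace M] (hR : g.IsRiemannian) {V : M → ℝ} {K : ℝ}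
    (hK : 0 < K) (hV : ContMDiff I 𝓘(ℝ, ℝ) ∞ V)
    (hRic : ∀ (y : M) (X : TangentSpace I y), K * g.val y X X ≤ g.ricci y X X + g.hessian V y X X)
    (hmass1 : ∫ x, Real.exp (-V x) ∂g.riemVolume = 1) {u : ℝ → M → ℝ}
    (hu : ContMDiffOn (I.prod 𝓘(ℝ, ℝ)) 𝓘(ℝ, ℝ) ∞ (fun p : M × ℝ ↦ u p.2 p.1) (univ ×ˢ Ici 0))
    (heq : ∀ t ∈ Ici (0 : ℝ), ∀ x, derivWithin (fun s ↦ u s x) (Ici 0) t =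
      g.dalembertian (u t) x - g.innerDual x (mvfderiv I V x : TangentSpace I x →ₗ[ℝ] ℝ)
        (mvfderiv I (u t) x : TangentSpace I x →ₗ[ℝ] ℝ)) :
    TendstoUniformly (fun t ↦ u t)
      (fun _ ↦ ∫ x, u 0 x * Real.exp (-V x) ∂g.riemVolume) atTop := by
  haveI : Nonempty M := ConnectedSpace.toNonempty
  have hslice : ∀ s ∈ Ici (0 : ℝ), ContMDiff I 𝓘(ℝ, ℝ) ∞ (u s) := fun s hs ↦
    hu.comp_contMDiff (contMDiff_id.prodMk contMDiff_const) fun y ↦ ⟨mem_univ _, hs⟩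
  -- a bound for `|∇u(0)|²` on the compact manifold
  have hQc : Continuous (g.gradSq (u 0)) := (contMDiff_gradSq g (hslice 0 self_mem_Ici)).continuous
  obtain ⟨C, hC⟩ := (isCompact_univ (X := M)).exists_bound_of_continuousOn hQc.continuousOn
  have hC' : ∀ y, g.gradSq (u 0) y ≤ C := fun y ↦
    (Real.le_norm_self _).trans (hC y (mem_univ _))
  have hdecay := heatFlow_gradSq_le g hR hV hRic hu heq hC'
  have hCnn : 0 ≤ C := (norm_nonneg _).trans (hC (Classical.arbitrary M) (mem_univ _))
  refine tendstoUniformly_of_gradSq_tendsto_zero g hR hV hmass1 ?_ ?_ ?_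
  · filter_upwards [eventually_ge_atTop (0 : ℝ)] with t ht
    exact (hslice t ht).of_le (by norm_num)
  · intro ε hε
    -- `e^{−2Kt} C ≤ ε` for large `t`
    have hlim : Tendsto (fun t : ℝ ↦ Real.exp (-2 * K * t) * C) atTop (𝓝 0) := by
      have h1 : Tendsto (fun t : ℝ ↦ -2 * K * t) atTop atBot :=
        tendsto_id.const_mul_atTop_of_neg (by linarith)
      have h2 := Real.tendsto_exp_atBot.comp h1
      simpa using h2.mul_const C
    have hev : ∀ᶠ t in atTop, Real.exp (-2 * K * t) * C ≤ ε := by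
      have h := (Metric.tendsto_nhds.1 hlim) ε hε
      filter_upwards [h] with t ht
      rw [Real.dist_eq, sub_zero] at ht
      exact (le_abs_self _).trans ht.le
    filter_upwards [hev, eventually_ge_atTop (0 : ℝ)] with t ht ht0
    exact fun y ↦ (hdecay t ht0 y).trans ht
  · filter_upwards [eventually_ge_atTop (0 : ℝ)] with t ht
    exact heatFlow_integral_eq g hR hV hu heq t ht

/-- **The Bakry–Émery logarithmic Sobolev inequality from the EXISTENCE of the weighted heat
flow** (`logSobolev_of_heatFlow` with positivity supplied by the minimum principle
`heatFlow_ge_of_ge` and convergence to equilibrium by `heatFlow_tendstoUniformly`): for `g`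
Riemannian on a closed connected manifold, `V` smooth with `Ric + Hess V ≥ K g`, `K > 0`,
`∫ e^{-V} dV_g = 1`, IF every smooth `h₀` is the initial value of a solution `u` smooth on
`M × [0, ∞)` of `∂ₜu = Δu − g⁻¹(dV, du)`, THEN `∫ φ e^φ e^{-V} ≤ (1/2K) ∫ |∇φ|² e^φ e^{-V}` for
all smooth `φ` with `∫ e^φ e^{-V} = 1`. [cite: CarrilloNi2009, §3 (pp. 7–8)] -/
theorem logSobolev_of_heatExistence [ConnectedSpace M] (hR : g.IsRiemannian) {V : M → ℝ} {K : ℝ}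
    (hK : 0 < K) (hV : ContMDiff I 𝓘(ℝ, ℝ) ∞ V)
    (hRic : ∀ (y : M) (X : TangentSpace I y), K * g.val y X X ≤ g.ricci y X X + g.hessian V y X X)
    (hmass : ∫ x, Real.exp (-V x) ∂g.riemVolume = 1)
    (hexist : ∀ h₀ : M → ℝ, ContMDiff I 𝓘(ℝ, ℝ) ∞ h₀ →
      ∃ u : ℝ → M → ℝ,
        ContMDiffOn (I.prod 𝓘(ℝ, ℝ)) 𝓘(ℝ, ℝ) ∞ (fun p : M × ℝ ↦ u p.2 p.1) (univ ×ˢ Ici 0) ∧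
        u 0 = h₀ ∧
        (∀ t ∈ Ici (0 : ℝ), ∀ x, derivWithin (fun s ↦ u s x) (Ici 0) t =
          g.dalembertian (u t) x - g.innerDual x (mvfderiv I V x : TangentSpace I x →ₗ[ℝ] ℝ)
            (mvfderiv I (u t) x : TangentSpace I x →ₗ[ℝ] ℝ)))
    (φ : M → ℝ) (hφ : ContMDiff I 𝓘(ℝ, ℝ) ∞ φ)
    (hφmass : ∫ x, Real.exp (φ x) * Real.exp (-V x) ∂g.riemVolume = 1) :
    ∫ x, φ x * (Real.exp (φ x) * Real.exp (-V x)) ∂g.riemVolume ≤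
      1 / (2 * K) * ∫ x, g.gradSq φ x * (Real.exp (φ x) * Real.exp (-V x)) ∂g.riemVolume := by
  haveI : Nonempty M := ConnectedSpace.toNonempty
  refine logSobolev_of_heatFlow g hR hK hV hRic hmass ?_ φ hφ hφmass
  intro h₀ hh₀ hpos
  obtain ⟨u, hu, hu0, hueq⟩ := hexist h₀ hh₀
  -- positivity from the minimum principle, with `a = min h₀ > 0`
  obtain ⟨xm, -, hxm⟩ := (isCompact_univ (X := M)).exists_isMinOn univ_nonempty
    hh₀.continuous.continuousOn
  have ha : ∀ x, h₀ xm ≤ u 0 x := fun x ↦ by rw [hu0]; exact hxm (mem_univ x)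
  have hupos : ∀ t ∈ Ici (0 : ℝ), ∀ x, 0 < u t x := fun t ht x ↦
    lt_of_lt_of_le (hpos xm) (heatFlow_ge_of_ge g hR hu hueq ha t ht x)
  refine ⟨u, hu, hupos, hu0, hueq, ?_⟩
  have h := heatFlow_tendstoUniformly g hR hK hV hRic hmass hu hueq
  rw [hu0] at h
  exact h

end Convergence

/-! ### Carrillo–Ni's Cor. 4.1 (closed case) from the existence of the weighted heat flow -/

/-- **`carrilloNi_muEntropy_eq_log_shrinkerDensity` follows from the EXISTENCE of smooth
solutions of the weighted heat equation on closed weighted manifolds.** Hypothesis `hExist`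
(the one remaining analytic input, a standard theorem on linear parabolic equations on closed
manifolds — e.g. A. Grigor'yan, *Heat kernel and analysis on manifolds* (2009), Ch. 7, for the
weighted manifold `(M, g, e^{-V}dV_g)`: the heat semigroup `P_t = e^{tL}`, `L = Δ_g − g⁻¹(dV, d·)`,
maps `C^∞(M)` to solutions smooth on `[0, ∞) × M`): for `g` Riemannian on a closed connected
manifold (any model space with values in a universe-`u` type), `V` and `h₀` smooth, there is
`u : ℝ → M → ℝ` smooth on `M × [0, ∞)` with `u(0, ·) = h₀` and `∂ₜu = Δ_g u − g⁻¹(dV, du)` on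
`[0, ∞) × M` (one-sided time derivative at `t = 0`). CONCLUSION: the named fact (Carrillo–Ni 2009,
Cor. 4.1, closed case). Everything else — positivity (minimum principle), conservation of mass,
the Bakry–Émery gradient bound and convergence to equilibrium, the entropy dissipation along the
flow, the logarithmic Sobolev inequality of Bakry–Émery, and Carrillo–Ni's computation
`μ(g,1) = log Θ` — is proved in the tree (`GradientShrinkerProofs.lean`,
`CoordFisherDissipation.lean`, `BakryEmeryHeatFlow.lean`, `BakryEmerySpectralGap.lean`,
`WeightedHeatFlowAPriori.lean`, this file). [cite: CarrilloNi2009, §3–§4 and Cor. 4.1] -/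
theorem carrilloNi_muEntropy_eq_log_shrinkerDensity_of_heatExistence
    (hExist : ∀ (E : Type u) [NormedAddCommGroup E] [NormedSpace ℝ E] [FiniteDimensional ℝ E]
      (H : Type u) [TopologicalSpace H] (I : ModelWithCorners ℝ E H) [I.Boundaryless]
      (M : Type u) [TopologicalSpace M] [ChartedSpace H M] [IsManifold I ∞ M] [T3Space M]
      [MeasurableSpace M] [BorelSpace M] [CompactSpace M] [ConnectedSpace M]
      (g : PseudoRiemannianMetric I ∞ E (TangentSpace I : M → Type _)) [g.HasLeviCivita]
      (V : M → ℝ) (h₀ : M → ℝ), g.IsRiemannian → ContMDiff I 𝓘(ℝ, ℝ) ∞ V →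
      ContMDiff I 𝓘(ℝ, ℝ) ∞ h₀ →
      ∃ u : ℝ → M → ℝ,
        ContMDiffOn (I.prod 𝓘(ℝ, ℝ)) 𝓘(ℝ, ℝ) ∞ (fun p : M × ℝ ↦ u p.2 p.1) (univ ×ˢ Ici 0) ∧
        u 0 = h₀ ∧
        (∀ t ∈ Ici (0 : ℝ), ∀ x, derivWithin (fun s ↦ u s x) (Ici 0) t =
          g.dalembertian (u t) x - g.innerDual x (mvfderiv I V x : TangentSpace I x →ₗ[ℝ] ℝ)
            (mvfderiv I (u t) x : TangentSpace I x →ₗ[ℝ] ℝ))) :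
    carrilloNi_muEntropy_eq_log_shrinkerDensity.{u} :=
  carrilloNi_muEntropy_eq_log_shrinkerDensity_of_bakryEmery
    fun E _ _ _ H _ I _ M _ _ _ _ _ _ _ _ g _ V _K hg hV hK hRic hmass φ hφ hφmass ↦
      logSobolev_of_heatExistence g hg hK hV hRic hmass
        (fun h₀ hh₀ ↦ hExist E H I M g V h₀ hg hV hh₀) φ hφ hφmass

end Literature.Geometry.Riemannian

end
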